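import Summits.HodgeConjecture.HodgeConjecture.Theorems.Ring2AbelianAllAndreFibreClassDivisionNodes
import Summits.HodgeConjecture.HodgeConjecture.Theorems.Ring2AbelianAllAndreFibreClassDivisionFamily
import HarnessLib

/-!
# Ring 2 · sub-cell AbelianAll (ALL ABELIAN VARIETIES), André axis, part XXIX-d — RUNGS OF DIVISION AND OF THE LIFT FROM
# "HOM ≡ NUM" IN CODIMENSION `≤ 2` (Matsusaka, Lieberman): (Div) and (L) in the degrees `p ≤ 1`, `p ≥ d − 1` on every compact
# abelian pencil; the lift in EVERY degree for EVERY smooth projective family of relative dimension `≤ 3` over a curve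

HONEST FRAMING (page 1, verbatim): **research route, not a corollary; conditional on HC_CM plus one named
minimal statement.** Cell line: research route conditional on HC_CM; not a corollary; Q11.4-sentence-2
already refuted in dim ≥ 3. Nothing in this file proves a case of the Hodge conjecture for an abelian variety. `HC_CM`
does NOT occur in this file; item `Theses.RankFourFaces.CMToAbelian` (stmt-HodgeConjecture-16267) OPEN and not closed here.
Seat `pub-hodge-ring2-ab-andre-2`, gen 21; continuation of parts XXIX-a/b/c. Brief (iii) "what is known … smallest open instance".

## The point

Parts XXIX-a/b reduced division by the fibre class, and with it the lift (L)_t(p), to homological ≡ numerical equivalence on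
the TOTAL SPACE in the two bidegrees `(p, q + m)` (right kernel) and `(p + m, q)` (left kernel), `p + q = n` the relative
dimension, `m` the dimension of the base. Part XVIII-f (`Ring2AbelianAllAndreHomNumUnconditional`) carries, for EVERY smooth
complex projective variety, "hom ≡ num" in codimension `≤ 2` and in dimension `≤ 1` (Matsusaka; Lieberman 1968, via `A` in
codimension `≤ 1` = Lefschetz (1,1) + hard Lefschetz, Kleiman's graded argument of part XVIII-d) — kernel theorems. Feeding the
latter into the former:
* on every compact pencil of abelian `d`-folds, **Div[t, p] and (L)_t(p) hold for `p ≤ 1` and for `p ≥ d − 1`** (every point, no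
  hypothesis) — for (L) this re-proves part XVIII-f's `comap_le_sup_of_extreme` without Lieberman's theorem on the FIBRE; for (Div)
  it is new; both hold in every degree for `d ≤ 3`, and the first open rung of either is the middle degree `(d, p) = (4, 2)`;
* **for EVERY smooth projective family `f : 𝒳 ⟶ S` over a smooth projective CURVE with smooth projective total space, of ANY
  fibre type, the lift (L)_t(p) — "a class of `H^{2p}(𝒳)` algebraic on the fibre `𝒳_t` lies in `N^p(𝒳) + ker j_t^*`; an invariant
  class algebraic on one fibre is the restriction of an algebraic class, hence algebraic on every fibre" — holds for `p ≤ 1` and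
  `p ≥ n − 1`, so in EVERY degree when the relative dimension is `n ≤ 3`** (families of curves, surfaces — K3, abelian, general
  type — and threefolds — Calabi–Yau, … — alike); over a base of dimension `m` the degrees with `(p ≤ 1 ∨ q + m ≤ 2) ∧ (q ≤ 1 ∨ p + m ≤ 2)`.

## What is proved (theorems only; no definition, no named fact, no sorry)

§1 (compact abelian pencils; bracket `Div[hf, t, p]` of part XXIX-c, display-only): `fibreClassDivisionAt_of_extreme`
(`p ≤ 1 ∨ d ≤ p + 1`), `fibreClassDivisionAt_one`, `fibreClassDivisionAt_sub_one`, **`fibreClassDivisionAt_of_relDim_le_three`**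
(every degree, `d ≤ 3`), `fibreClassDivisionAt_of_relDim_four_of_ne_two` (`d = 4`: every degree but the middle);
`comap_le_sup_of_extreme'` ((L)_t(p), `p ≤ 1 ∨ d ≤ p + 1`, fibre-free proof).
§2 (ANY smooth projective family over a smooth projective base): **`comap_le_sup_of_extreme_family`**;
`comap_le_sup_of_curveBase_of_extreme` (`m = 1`: `p ≤ 1 ∨ n ≤ p + 1`); **`comap_le_sup_of_curveBase_of_relDim_le_three`**
(`m = 1`, `n ≤ 3`: every `p`, every `t`); the free-dimension forms `…'`.

## Honest status

Nothing here is progress on `HC_AV`: the abelian-pencil rungs coincide with the known rungs of (L) (part XVIII-f), now with a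
fibre-free proof and with (Div); the general-family statement is the classical-input consequence of parts XXIX-a/b and XVIII-d/f
(for `n ≤ 3` over a curve every codimension involved on the total `(n+1)`-fold is `≤ 2` or `≥ n − 1 + 1 - 1`, where hom ≡ num is
Lieberman's theorem) — recorded as a theorem of the tree, not as a claim of novelty in print (for `p = 1` it is the theorem on
`(1,1)`-classes in families; for curve classes on threefold-fibred fourfolds the seat knows no printed statement in this form and
flags it for the literature seat). As everywhere on this axis the total space and the base are smooth projective and the family
is smooth (all fibres smooth). No node is born; nothing is minimal.

References: Lieberman1968 (Thm. 1); Kleiman1968AlgebraicCycles (§3, Cor. 3.9); Grothendieck1968 (§3 p. 196); Abdulali1994FamiliesAV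
(Conj. 5.3, Thm. 5.5, p. 1122); Milne2020HodgeClassesAV (Prop. 1 p. 7); Andre1996Motifs (Thm. 0.5, §5.1, Remarque 2); VoisinHodgeI2002
(Thm. 11.30); VoisinHodgeII2003 (§4.3.1 Thm. 4.18); HatcherAT2002 (§3.3 Thm. 3.26).
-/

noncomputable section

set_option linter.dupNamespace false

namespace Summit.HodgeConjecture.HodgeConjecture.Ring2.AbelianAll

open CategoryTheory AlgebraicGeometry
open Literature.AlgebraicGeometry Literature.AlgebraicGeometry.Motives
open Literature.AlgebraicGeometry.HodgeTheory
open Literature.AlgebraicTopology.SingularHomology (singularCohomology cupProduct)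
open Summit.HodgeConjecture.HodgeConjecture
open Summit.HodgeConjecture.HodgeConjecture.Theorems (fulton1998_map_mem_algebraicClasses_holds)

variable {𝒳 S : SchemeOver ℂ} {d : ℕ} {f : 𝒳 ⟶ S}

/-- The display-only bracket of part XXIX-c (re-declared locally; notation, census-invisible): `Div[hf, t, p]` iff
`L_t⁻¹ N^{p+1}(𝒳) ≤ N^p(𝒳) + ker j_t^*`, `L_t = j_{t*} j_t^*`. [cite: Grothendieck1968, §3 p. 196 (A(X, L))]
[cite: Abdulali1994FamiliesAV, Conjecture 5.3 (p. 1130)] -/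
local notation3 "Div[" hf ", " t ", " p "]" =>
  Submodule.comap ((fiberGysin hf t p) ∘ₗ (complexBetti.map (fiberι f t) (2 * p)).hom) (algebraicClasses 𝒳 (p + 1)) ≤
    algebraicClasses 𝒳 p ⊔ LinearMap.ker (complexBetti.map (fiberι f t) (2 * p)).hom

/-! ## §1 Compact abelian pencils: (Div) and (L) in the degrees `p ≤ 1`, `p ≥ d - 1` -/

/-- **Div[t, p] holds for `p ≤ 1` and for `p ≥ d − 1`, on every compact pencil of abelian `d`-folds, at every point.** The two
"hom ≡ num" hypotheses of part XXIX-a live in the bidegrees `(p, q+1)` (right) and `(p+1, q)` (left) of the `(d+1)`-fold `𝒳`;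
for `p ≤ 1` or `q ≤ 1` each has a factor of codimension `≤ 2` or `≥ dim 𝒳 − 1`, where hom ≡ num is a tree theorem (part XVIII-f,
Matsusaka–Lieberman). [cite: Lieberman1968, Thm. 1] [cite: Kleiman1968AlgebraicCycles, §3 Cor. 3.9] -/
theorem fibreClassDivisionAt_of_extreme (hf : IsCompactAbelianPencil f d) (t : ComplexPoints S) {p q : ℕ} (hpq : p + q = d)
    (h : p ≤ 1 ∨ d ≤ p + 1) : Div[hf, t, p] :=
  fibreClassDivisionAt_of_numerical hf t hpq
    (fun _ hw horth ↦ eq_zero_of_forall_cupProduct_algebraic_eq_zero_of_extreme' hf.isSmoothProjective_total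
      (show p + (q + 1) = d + 1 by omega) (by omega)
      (fiberGysin_mem_algebraicClasses hf t (algebraicClasses_sup_ker_le_comap hf q t (Submodule.mem_sup_left hw))) horth)
    (fun _ hx horth ↦ eq_zero_of_forall_cupProduct_algebraic_eq_zero_of_extreme hf.isSmoothProjective_total
      (show (p + 1) + q = d + 1 by omega) (by omega) hx horth)

/-- **Div[t, 1] on every compact abelian pencil** (divisors against `1`-cycles of the total space; vacuous for `d = 0`).
[cite: Lieberman1968, Thm. 1] [cite: VoisinHodgeI2002, Thm. 11.30] -/
theorem fibreClassDivisionAt_one (hf : IsCompactAbelianPencil f d) (t : ComplexPoints S) : Div[hf, t, 1] := by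
  rcases Nat.lt_or_ge d 1 with hd | hd
  · exact fibreClassDivisionAt_of_lt hf hd t
  · exact fibreClassDivisionAt_of_extreme hf t (show 1 + (d - 1) = d by omega) (Or.inl le_rfl)

/-- **Div[t, d − 1] on every compact abelian pencil** (`1`-cycles of the fibre). [cite: Lieberman1968, Thm. 1] -/
theorem fibreClassDivisionAt_sub_one (hf : IsCompactAbelianPencil f d) (t : ComplexPoints S) : Div[hf, t, d - 1] := by
  rcases Nat.eq_zero_or_pos d with rfl | hd
  · exact fibreClassDivisionAt_zero hf t
  · exact fibreClassDivisionAt_of_extreme hf t (show (d - 1) + 1 = d by omega) (Or.inr (by omega))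

/-- **(Div) IN EVERY DEGREE FOR COMPACT PENCILS OF ABELIAN CURVES, SURFACES AND THREEFOLDS** (`d ≤ 3`: every `p ≤ d` has `p ≤ 1`
or `p ≥ d − 1`). The first open rung of (Div), as of (L), is `(d, p) = (4, 2)`. [cite: Lieberman1968, Thm. 1]
[cite: Abdulali1994FamiliesAV, Theorem 5.5 (p. 1130)] -/
theorem fibreClassDivisionAt_of_relDim_le_three (hf : IsCompactAbelianPencil f d) (hd : d ≤ 3) (p : ℕ) (t : ComplexPoints S) :
    Div[hf, t, p] := by
  rcases Nat.lt_or_ge d p with hp | hp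
  · exact fibreClassDivisionAt_of_lt hf hp t
  · exact fibreClassDivisionAt_of_extreme hf t (show p + (d - p) = d by omega) (by omega)

/-- **`d = 4`: (Div) holds in every degree except possibly the middle one, `p = 2`** (compact pencils of abelian fourfolds; fivefold
total spaces). [cite: Lieberman1968, Thm. 1] [cite: Kleiman1968AlgebraicCycles, §3] -/
theorem fibreClassDivisionAt_of_relDim_four_of_ne_two (hf : IsCompactAbelianPencil f 4) {p : ℕ} (hp : p ≠ 2)
    (t : ComplexPoints S) : Div[hf, t, p] := by
  rcases Nat.lt_or_ge 4 p with hp' | hp'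
  · exact fibreClassDivisionAt_of_lt hf hp' t
  · exact fibreClassDivisionAt_of_extreme hf t (show p + (4 - p) = 4 by omega) (by omega)

/-- **(L)_t(p) for `p ≤ 1 ∨ d ≤ p + 1`, fibre-free proof** (part XVIII-f's `comap_le_sup_of_extreme` used Lieberman on the fibre for
(Perf_t); here Div ⟹ L). [cite: Lieberman1968, Thm. 1] [cite: Milne2020HodgeClassesAV, Prop. 1 (p. 7)] -/
theorem comap_le_sup_of_extreme' (hf : IsCompactAbelianPencil f d) (t : ComplexPoints S) {p q : ℕ} (hpq : p + q = d)
    (h : p ≤ 1 ∨ d ≤ p + 1) :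
    (algebraicClasses (fiberOver f t) p).comap (complexBetti.map (fiberι f t) (2 * p)).hom ≤
      algebraicClasses 𝒳 p ⊔ LinearMap.ker (complexBetti.map (fiberι f t) (2 * p)).hom :=
  comap_le_sup_of_fibreClassDivisionAt hf (fibreClassDivisionAt_of_extreme hf t hpq h)

/-! ## §2 Every smooth projective family: the lift in the extreme degrees; every degree for relative dimension `≤ 3` over a curve -/

section Family

variable {n m : ℕ}

/-- **THE LIFT IN THE EXTREME BIDEGREES — EVERY SMOOTH PROJECTIVE FAMILY.** `f : 𝒳 ⟶ S` smooth projective of relative dimension `n`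
over a smooth projective base of dimension `m`, total space smooth projective of dimension `n + m`, a point `t`, `p + q = n`. If
`p ≤ 1 ∨ q + m ≤ 2` and `q ≤ 1 ∨ p + m ≤ 2`, then `(j_t^*)⁻¹ N^p(𝒳_t) ≤ N^p(𝒳) + ker j_t^*` (part XXIX-b's two "hom ≡ num" hypotheses
have a factor of codimension `≤ 2` or `≥ dim 𝒳 − 1`: part XVIII-f). NO hypothesis on the fibres. [cite: Lieberman1968, Thm. 1]
[cite: Kleiman1968AlgebraicCycles, §3 Cor. 3.9] [cite: Andre1996Motifs, §5.1 and Thm. 0.5] -/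
theorem comap_le_sup_of_extreme_family (hS : IsSmoothProjective m S) (hf : IsSmoothProjectiveFamily f n)
    (h𝒳 : IsSmoothProjective (n + m) 𝒳) (t : ComplexPoints S) {p q : ℕ} (hpq : p + q = n) (h₁ : p ≤ 1 ∨ q + m ≤ 2)
    (h₂ : q ≤ 1 ∨ p + m ≤ 2) :
    (algebraicClasses (fiberOver f t) p).comap (complexBetti.map (fiberι f t) (2 * p)).hom ≤
      algebraicClasses 𝒳 p ⊔ LinearMap.ker (complexBetti.map (fiberι f t) (2 * p)).hom :=
  comap_le_sup_of_nondegenerate_family hS hf h𝒳 t hpq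
    (fun _ hb h0 ↦ eq_zero_of_forall_cupProduct_algebraic_eq_zero_of_extreme' h𝒳 (show p + (q + m) = n + m by omega)
      (by omega) hb h0)
    (fun _ ha h ↦ eq_zero_of_forall_cupProduct_algebraic_eq_zero_of_extreme h𝒳 (show (p + m) + q = n + m by omega)
      (by omega) ha h)

/-- **Over a smooth projective CURVE: the lift for `p ≤ 1` and for `p ≥ n − 1`, every smooth projective family, every point**
(degrees `p > n` vacuous). [cite: Lieberman1968, Thm. 1] [cite: Andre1996Motifs, §5.1 and Thm. 0.5] -/
theorem comap_le_sup_of_curveBase_of_extreme (hS : IsSmoothProjective 1 S) (hf : IsSmoothProjectiveFamily f n)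
    (h𝒳 : IsSmoothProjective (n + 1) 𝒳) (t : ComplexPoints S) {p : ℕ} (h : p ≤ 1 ∨ n ≤ p + 1) :
    (algebraicClasses (fiberOver f t) p).comap (complexBetti.map (fiberι f t) (2 * p)).hom ≤
      algebraicClasses 𝒳 p ⊔ LinearMap.ker (complexBetti.map (fiberι f t) (2 * p)).hom := by
  rcases Nat.lt_or_ge n p with hp | hp
  · intro W _
    haveI := subsingleton_complexBetti (hf.isSmoothProjective t) (show 2 * n < 2 * p by omega)
    exact Submodule.mem_sup_right (LinearMap.mem_ker.2 (Subsingleton.elim _ _))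
  · exact comap_le_sup_of_extreme_family hS hf h𝒳 t (show p + (n - p) = n by omega) (by omega) (by omega)

/-- **THE LIFT IN EVERY DEGREE FOR EVERY SMOOTH PROJECTIVE FAMILY OF CURVES, SURFACES OR THREEFOLDS OVER A SMOOTH PROJECTIVE CURVE**
(smooth projective total space; ANY fibres — K3, abelian, Calabi–Yau, general type …): for every point `t` and every `p`, a class
of `H^{2p}(𝒳(ℂ); ℂ)` algebraic on `𝒳_t` lies in `N^p(𝒳) + ker j_t^*`; in particular a monodromy-invariant class algebraic on ONE
fibre is the restriction of an algebraic class of the total space and is algebraic on EVERY fibre. Inputs: Gysin formalism,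
Deligne's kernel identity and hom ≡ num in codimension `≤ 2` / dimension `≤ 1` on the `(n+1)`-fold — all tree theorems.
[cite: Lieberman1968, Thm. 1] [cite: Kleiman1968AlgebraicCycles, §3 Cor. 3.9] [cite: Andre1996Motifs, Thm. 0.5 and §5.1]
[cite: DeligneHodgeII1971, Thm. 4.1.1] -/
theorem comap_le_sup_of_curveBase_of_relDim_le_three (hS : IsSmoothProjective 1 S) (hf : IsSmoothProjectiveFamily f n)
    (hn : n ≤ 3) (h𝒳 : IsSmoothProjective (n + 1) 𝒳) (p : ℕ) (t : ComplexPoints S) :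
    (algebraicClasses (fiberOver f t) p).comap (complexBetti.map (fiberι f t) (2 * p)).hom ≤
      algebraicClasses 𝒳 p ⊔ LinearMap.ker (complexBetti.map (fiberι f t) (2 * p)).hom :=
  comap_le_sup_of_curveBase_of_extreme hS hf h𝒳 t (by omega)

/-- The same with the dimension of the total space a free parameter `N` (`N = n + 1` by the dimension count of part XII-c).
[cite: Lieberman1968, Thm. 1] [cite: Andre1996Motifs, Thm. 0.5] -/
theorem comap_le_sup_of_curveBase_of_relDim_le_three' {N : ℕ} (hS : IsSmoothProjective 1 S) (hf : IsSmoothProjectiveFamily f n)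
    (hn : n ≤ 3) (h𝒳 : IsSmoothProjective N 𝒳) (p : ℕ) (t : ComplexPoints S) :
    (algebraicClasses (fiberOver f t) p).comap (complexBetti.map (fiberι f t) (2 * p)).hom ≤
      algebraicClasses 𝒳 p ⊔ LinearMap.ker (complexBetti.map (fiberι f t) (2 * p)).hom := by
  obtain rfl : N = n + 1 := dim_total_eq_add hS hf h𝒳
  exact comap_le_sup_of_curveBase_of_relDim_le_three hS hf hn h𝒳 p t

/-- **Consequence for invariant classes (curve base, `n ≤ 3`): an algebraic class on one fibre that is the restriction of SOME
global class is the restriction of an ALGEBRAIC global class, hence restricts to an algebraic class on every fibre.**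
[cite: Andre1996Motifs, Thm. 0.5 and §5.1] [cite: Lieberman1968, Thm. 1] -/
theorem exists_algebraic_lift_of_curveBase_of_relDim_le_three (hS : IsSmoothProjective 1 S) (hf : IsSmoothProjectiveFamily f n)
    (hn : n ≤ 3) (h𝒳 : IsSmoothProjective (n + 1) 𝒳) (t : ComplexPoints S) {p : ℕ} (W : complexBetti 𝒳 (2 * p))
    (hW : complexBetti.map (fiberι f t) (2 * p) W ∈ algebraicClasses (fiberOver f t) p) :
    ∃ x ∈ algebraicClasses 𝒳 p, complexBetti.map (fiberι f t) (2 * p) x = complexBetti.map (fiberι f t) (2 * p) W ∧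
      ∀ s : ComplexPoints S, complexBetti.map (fiberι f s) (2 * p) W ∈ algebraicClasses (fiberOver f s) p := by
  have hmem := comap_le_sup_of_curveBase_of_relDim_le_three hS hf hn h𝒳 p t hW
  obtain ⟨x, hx, k, hk, hxk⟩ := Submodule.mem_sup.1 hmem
  have hk' : complexBetti.map (fiberι f t) (2 * p) k = 0 := LinearMap.mem_ker.1 hk
  have hxt : complexBetti.map (fiberι f t) (2 * p) x = complexBetti.map (fiberι f t) (2 * p) W := by
    rw [← hxk, map_add, hk', add_zero]
  refine ⟨x, hx, hxt, fun s ↦ ?_⟩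
  -- `W - x` dies on `𝒳_t`, hence on every fibre (Deligne's kernel identity, part XII-e), so `j_s^* W = j_s^* x` is algebraic
  have h0 : complexBetti.map (fiberι f s) (2 * p) (W - x) = 0 :=
    restrict_eq_zero_of_complexGysin_eq_zero hS hf h𝒳 (show 2 * p + 2 * (n + 1) = 2 * (p + 1) + 2 * n by omega) t s (W - x)
      (by rw [map_sub, hxt, sub_self, map_zero])
  have hWs : complexBetti.map (fiberι f s) (2 * p) W = complexBetti.map (fiberι f s) (2 * p) x := by
    rw [map_sub, sub_eq_zero] at h0
    exact h0
  rw [hWs]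
  exact fulton1998_map_mem_algebraicClasses_holds (fiberι f s) h𝒳 (hf.isSmoothProjective s) p x hx

end Family

end Summit.HodgeConjecture.HodgeConjecture.Ring2.AbelianAll

end
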